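import Summits.NavierStokesRegularity.TurbBounds.SpectralFormFreeSlip
import Summits.NavierStokesRegularity.TurbBounds.Results.FSU1
import Summits.NavierStokesRegularity.TurbBounds.FSU1.Mode.M01Calculus
import Summits.NavierStokesRegularity.TurbBounds.FSU1.Mode.M03Defs
import Summits.NavierStokesRegularity.TurbBounds.FSU1.Mode.M04Young
import Summits.NavierStokesRegularity.TurbBounds.FSU1.Mode.M05RegimeI
import Summits.NavierStokesRegularity.TurbBounds.FSU1.Mode.M06PhiRegime
import Summits.NavierStokesRegularity.TurbBounds.FSU1.Mode.M07Parity
import Summits.NavierStokesRegularity.TurbBounds.FSU1.Mode.M08CouplingSlope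
import Summits.NavierStokesRegularity.TurbBounds.FSU1.Mode.M09CouplingRemainder
import Summits.NavierStokesRegularity.TurbBounds.FSU1.Mode.M10MajorH
import Summits.NavierStokesRegularity.TurbBounds.FSU1.Mode.M11MajorJ
import Summits.NavierStokesRegularity.TurbBounds.FSU1.Mode.M12StiffnessOdd
import Summits.NavierStokesRegularity.TurbBounds.FSU1.Mode.M13StiffnessEven
import Summits.NavierStokesRegularity.TurbBounds.FSU1.Mode.M14Schur
import Summits.NavierStokesRegularity.TurbBounds.FSU1.Mode.M16CellPackage
import Summits.NavierStokesRegularity.TurbBounds.FSU1.Mode.M17EdgePackage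

/-!
# FS-U1″ mode lemma — ModeLemma (`TurbBounds/FSU1/Mode/M18ModeLemma.lean`)

The composition: `modeLemma_of_parts` and the proved mode lemma `fsu1ModeLemma : Results.FSU1.FSU1ModeLemma`.

Cell-made mathematics of FS-PROOF-DRAFT §3 (pub-turb-sos), kernel-checked; generated from the design compose file
`StageF_compose.check.lean` (96c4b9bf…) by `build_mode_split.py`.  HONEST FRAMING: rigorous bounds for the stated PDE and boundary conditions; no claim about physical turbulence beyond the bound.
-/

open Real intervalIntegral MeasureTheory Set

namespace Summit.NavierStokesRegularity.TurbBounds.FSU1.Mode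

open Summit.NavierStokesRegularity.TurbBounds.SpectralFormFreeSlip
open Summit.NavierStokesRegularity.TurbBounds.FSU1
open Summit.NavierStokesRegularity.TurbBounds.Results.FSU1

/-! ## A.9 The composition -/

/-- From a stiffness bound `S² ≤ M'·W` and `σ M' ≤ 1`: `σ S² ≤ W`. -/
theorem stiff_to_sigma {σ M' S2 W : ℝ} (hσ : 0 < σ) (hW : 0 ≤ W) (hst : S2 ≤ M' * W)
    (hσM : σ * M' ≤ 1) : σ * S2 ≤ W := by
  by_cases hM : M' ≤ 0
  · have : S2 ≤ 0 := le_trans hst (mul_nonpos_of_nonpos_of_nonneg hM hW)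
    nlinarith
  · push Not at hM
    calc σ * S2 ≤ σ * (M' * W) := mul_le_mul_of_nonneg_left hst hσ.le
      _ = σ * M' * W := by ring
      _ ≤ 1 * W := mul_le_mul_of_nonneg_right hσM hW
      _ = W := one_mul W

/-- `W_half ≥ 0` when `α ≥ 0` and `αk² + β₀ ≥ 0`. -/
theorem Wh_nonneg {α β₀ k : ℝ} {V : ℝ → ℝ} (hα : 0 ≤ α) (hβ : 0 ≤ α * k ^ 2 + β₀) : 0 ≤ Wh α β₀ k V :=
  intervalIntegral.integral_nonneg (by norm_num) fun z _ => by
    exact add_nonneg (mul_nonneg hα (sq_nonneg _)) (mul_nonneg hβ (sq_nonneg _))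

/-- Both half-cell classes are non-negative given the scalar data and the four functional hypotheses. -/
theorem half_classes {α β₀ δ k σ eps : ℝ} (hα : 0 < α) (hβ₀ : 0 < β₀) (hδ : 0 < δ) (hδh : δ ≤ 1 / 2) (hk : 0 < k)
    (hd : SchurData α β₀ δ k σ eps) (hCS : CouplingSlope) (hCR : CouplingRemainder) (hSE : StiffnessEven)
    (hSO : StiffnessOdd) :
    (∀ V Θ : ℝ → ℝ, HalfEven V Θ → 0 ≤ Eh α β₀ δ k V Θ) ∧ (∀ V Θ : ℝ → ℝ, HalfOdd V Θ → 0 ≤ Eh α β₀ δ k V Θ) := by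
  obtain ⟨hσ, hMB, hM1, he0, he1, hcond⟩ := hd
  have hW0 : ∀ V : ℝ → ℝ, 0 ≤ Wh α β₀ k V := fun V => Wh_nonneg hα.le (by positivity)
  have hC1 : 0 ≤ Real.sqrt (δ ^ 3 * HnormSq (k * δ)) := Real.sqrt_nonneg _
  have hC2 : 0 ≤ Real.sqrt (Jfun (k * δ)) / k := by positivity
  constructor
  · intro V Θ h
    have hst := hSE α β₀ k V hα hβ₀ hk h.hV h.V0 h.V2 h.Vmid h.V3mid
    have hSig : σ * deriv V 0 ^ 2 ≤ Wh α β₀ k V :=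
      stiff_to_sigma hσ (hW0 V) hst (by rw [← mul_assoc]; exact hMB)
    exact half_nonneg hα hβ₀ hδ hδh h.hV h.hΘ h.V0 h.V2 hσ hC1 hC2 he0 he1 hSig
      (hCS δ k (deriv V 0) Θ hδ hk h.hΘ h.Θ0) (hCR δ k V Θ hδ hk h.hV h.V0 h.hΘ h.Θ0) hcond
  · intro V Θ h
    have hst := hSO α β₀ k V hα hβ₀ hk h.hV h.V0 h.V2 h.Vmid h.V2mid
    have hSig : σ * deriv V 0 ^ 2 ≤ Wh α β₀ k V := stiff_to_sigma hσ (hW0 V) hst hM1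
    exact half_nonneg hα hβ₀ hδ hδh h.hV h.hΘ h.V0 h.V2 hσ hC1 hC2 he0 he1 hSig
      (hCS δ k (deriv V 0) Θ hδ hk h.hΘ h.Θ0) (hCR δ k V Θ hδ hk h.hV h.V0 h.hΘ h.Θ0) hcond

/-- Integrability of the tree integrand with the two-layer profile (as in `fsModeForm_nonneg_regimeI`). -/
theorem fsIntegrand_integrable_tau {Ra a b k δ : ℝ} {v θ : ℝ → ℝ} (hp : FreeSlipPair v θ) (hδ : 0 < δ)
    (hδ2 : δ ≤ 1 / 2) : IntervalIntegrable (fsIntegrand Ra a b (tauLayer δ) k v θ) volume 0 1 := by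
  have hθc : Continuous θ := hp.hθ.continuous
  have hvc : Continuous v := hp.hv.continuous
  have hθ' : Continuous (deriv θ) := continuous_deriv_of_contDiff_one hp.hθ
  have hΩ : Continuous (vort k v) := continuous_vort hp.hv k
  have hΩ' : Continuous (deriv (vort k v)) := continuous_deriv_vort hp.hv k
  obtain ⟨hHint, -⟩ := two_layer_term (τp := tauLayer δ) hvc hθc hδ hδ2 (tauLayer_eqOn_left _)
    (tauLayer_eqOn_mid _) (tauLayer_eqOn_right hδ2)
  have e : fsIntegrand Ra a b (tauLayer δ) k v θ = fun z => (deriv θ z ^ 2 + k ^ 2 * θ z ^ 2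
      + a / (Ra * Real.sqrt Ra) * (deriv (vort k v) z ^ 2 + k ^ 2 * vort k v z ^ 2) + b / Ra * vort k v z ^ 2)
      + 2 * tauLayer δ z * v z * θ z := by
    funext z; unfold fsIntegrand; ring
  rw [e]
  refine IntervalIntegrable.add ?_ hHint
  exact ((((hθ'.pow 2).add (continuous_const.mul (hθc.pow 2))).add
    (continuous_const.mul ((hΩ'.pow 2).add (continuous_const.mul (hΩ.pow 2))))).add
    (continuous_const.mul (hΩ.pow 2))).intervalIntegrable 0 1

/-- **Stage A.** The mode lemma from the seven analysis hypotheses (regime I by `regimeI_case`). -/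
theorem modeLemma_of_parts (hPar : ParityReduction) (hSE : StiffnessEven) (hSO : StiffnessOdd)
    (hCS : CouplingSlope) (hCR : CouplingRemainder) (hH : MajorH) (hJ : MajorJ) : FSU1ModeLemma := by
  intro p hS Ra hRa k hk hcov v θ hp
  obtain ⟨ha, hbp, hc, hD, hkapI, hρI1, hρIe, hk2, hbpk, hcdef, hD12, -⟩ := scalar_basics p hS
  by_cases hreg : (p.rhoI : ℝ) ≤ k * delta p.D Ra
  · exact regimeI_case p hS hRa hk hreg hp
  push Not at hreg
  -- `y = Ra^{1/12}`
  obtain ⟨y, hy, hy12, h512, hsqrt, hy2⟩ := twelfth_root hRa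
  have hRapos : 0 < Ra := lt_of_lt_of_le (by norm_num) hRa
  have hquarter : Ra ^ ((1:ℝ) / 4) = y ^ 3 := by
    rw [← hy12, show (y:ℝ) ^ 12 = (y ^ 3) ^ 4 by ring, show ((1:ℝ) / 4) = ((4:ℕ):ℝ)⁻¹ by norm_num]
    exact Real.pow_rpow_inv_natCast (by positivity) (by norm_num)
  have hδ : delta p.D Ra = (p.D:ℝ) / y ^ 5 := by unfold delta; rw [h512]
  have hδ0 : 0 < delta p.D Ra := by rw [hδ]; positivity
  have hδh : delta p.D Ra ≤ 1 / 2 := delta_le_half' hD12 hRa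
  set α : ℝ := (p.a:ℝ) / y ^ 18 with hαdef
  set β₀ : ℝ := (p.bp:ℝ) / y ^ 12 with hβdef
  have hα : 0 < α := by rw [hαdef]; positivity
  have hβ₀ : 0 < β₀ := by rw [hβdef]; positivity
  have hαeq : (p.a:ℝ) / (Ra * Real.sqrt Ra) = α := by
    rw [hαdef, hsqrt, ← hy12]; ring
  have hβeq : ((p.b:ℝ) - (p.a:ℝ) ^ 2 / 4) / Ra = β₀ := by
    rw [hβdef, ← hy12, cast_bp]
  -- `E₁ ≤ fsModeForm` (Young split at `u = 1`)
  have hI := fsIntegrand_integrable_tau (Ra := Ra) (a := (p.a:ℝ)) (b := (p.b:ℝ)) (k := k) hp hδ0 hδh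
  have hEu := Eu_le_fsModeForm (u := 1) (b := (p.b:ℝ)) (τp := tauFS p.D Ra) hp one_pos hRapos hk.le ha.le hI
  rw [Eu_one_eq_E1, hαeq, hβeq] at hEu
  refine le_trans ?_ hEu
  -- the scalar data from the cover hypothesis
  have hδ' : 0 < (p.D:ℝ) / y ^ 5 := by positivity
  have hδh' : (p.D:ℝ) / y ^ 5 ≤ 1 / 2 := by rw [← hδ]; exact hδh
  have hreg' : k * ((p.D:ℝ) / y ^ 5) < p.rhoI := by rw [← hδ]; exact hreg
  obtain ⟨σ, eps, hd⟩ : ∃ σ eps : ℝ, SchurData α β₀ ((p.D:ℝ) / y ^ 5) k σ eps := by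
    rcases hcov with ⟨ka, kb, eps, hcell, hka, hkb⟩ | ⟨eps, hcor, hkI⟩
    · rw [hquarter] at hka hkb
      exact ⟨_, _, cell_scalars p hS hy hy2 hk hcell hka hkb hH hJ⟩
    · rw [hquarter] at hkI
      exact ⟨_, _, edge_scalars p hS hy hy2 hk hcor hkI hreg' hH hJ⟩
  obtain ⟨hev, hod⟩ := half_classes hα hβ₀ hδ' hδh' hk hd hCS hCR hSE hSO
  have hτ : tauFS p.D Ra = tauLayer ((p.D:ℝ) / y ^ 5) := by unfold tauFS; rw [hδ]
  rw [hτ]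
  exact hPar α β₀ ((p.D:ℝ) / y ^ 5) k (tauLayer ((p.D:ℝ) / y ^ 5)) hα hβ₀ hδ' hδh' hk (tauLayer_eqOn_left _)
    (tauLayer_eqOn_mid _) (tauLayer_eqOn_right hδh') hev hod v θ hp

/-- The FS-U1″ mode lemma (B1‴, LEAD decision 122): the seven analysis hypotheses of `modeLemma_of_parts` are the
theorems `parityReduction` (M07), `couplingSlope` (M08), `couplingRemainder` (M09), `MH.majorH` (M10), `MJ.majorJ` (M11),
`SO.stiffnessOdd` (M12) and `SE.stiffnessEven` (M13); hence `Results.FSU1.FSU1ModeLemma` holds, discharging BY NAME the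
analytic hypothesis `hA` of `Results.FSU1.nusselt_bound` (row FS-U1″ then rests on the ONE cited reduction hypothesis
`FreeSlipReduction` [WD11]). -/
theorem fsu1ModeLemma : Summit.NavierStokesRegularity.TurbBounds.Results.FSU1.FSU1ModeLemma :=
  modeLemma_of_parts parityReduction SE.stiffnessEven SO.stiffnessOdd couplingSlope couplingRemainder MH.majorH MJ.majorJ

end Summit.NavierStokesRegularity.TurbBounds.FSU1.Mode
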